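/-
Copyright (c) 2026. All rights reserved.
Released under Apache 2.0 license as described in the file LICENSE.
-/
import Summits.AtomisticToContinuum.Crystallization.Theorems.ChartedZeroExcessLayeredLatticeLiouvilleVT

/-!
# ChartedZeroExcessLayeredLatticeLiouville — part VU «SlopeDecay»: the `ϱ`-UNIFORM decay of the slope blocks and the uniform bound of the box
  slope flux (decomp-a2c-lens-2, g58; helper of stmt-AtomisticToContinuum-26636, leaf (LD′) `ModalLipschitzZ`; brick (3) MODE EXTRACTION)

The slope block `slopeK (0,α) β g` (VT) is a sum over the layer-`β` section of the near set of bonds `nearK (0,α) Y (Σ_j Y_j • g j)`; each is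
bounded by `F(c)·N(Y − (0,α))⁻⁸ · N(Y − (0,α))·(‖g 0‖ + ‖g 1‖)` (UY `norm_layeredKernel_le`, the slope vector grows linearly), and the planar sum of
`N⁻⁷` over a layer section at height `s = |β − α| ≥ 1` is `≤ 49·s⁻⁵` (`sum_inv_idxNorm_pow_seven_le`: embed the section into the product of its
planar coordinate ranges, `Σ_x max(|x|,s)⁻⁴ ≤ 7 s⁻³` of VR times the new `Σ_x max(|x|,s)⁻² ≤ 7 s⁻¹`, times `s⁻¹`).  Hence
★ `norm_slopeK_le_decay : ‖slopeK (0,α) β g‖ ≤ 49·F(c)·|β − α|⁻⁵·(‖g 0‖ + ‖g 1‖)` UNIFORMLY IN `ϱ`, and summing over the band box with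
`|β − α|⁻⁵ ≤ (m − α + 1)⁻²(β − m)⁻²` (`inv_pow_five_le`) and VS `Σ (|m − n| + 1)⁻² ≤ 3` twice:
★★ `norm_boxSlope_le : ‖boxSlope ϱ a b w r g m‖ ≤ 441·F(c)·(‖g 0‖ + ‖g 1‖)` for EVERY band width `r`, every `ϱ`, every gap `m` and every stacking
word — the uniform datum bound of the mode extraction (part VV).
-/

namespace Summit.AtomisticToContinuum.Crystallization.Theorems.ChartedZeroExcessLayeredLatticeLiouville

open Summit.AtomisticToContinuum.Crystallization.Theorems.ChartedPlanarOrderRigidityDoor (E3)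
open Finset
open scoped InnerProductSpace RealInnerProductSpace BigOperators

noncomputable section SlopeDecay

variable {c : ℝ} {a b : E3} {w : ℤ → E3}

/-! ### VU.1  One-dimensional tail of order two -/

/-- the ONE-DIMENSIONAL TAIL of order two: `Σ_{x ∈ P} max(|x|, s)⁻² ≤ 7·s⁻¹` for every finite `P ⊆ ℤ` and `s ≥ 1` (`2s+1` central terms `s⁻²`;
the two tails `Σ_{k>s} k⁻² ≤ 2/(s+1)` each; the proof of VR `sum_inv_max_pow_four_le`). [this file, g58] -/
theorem sum_inv_max_sq_le (P : Finset ℤ) {s : ℕ} (hs : 1 ≤ s) :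
    ∑ x ∈ P, ((max ((x.natAbs : ℕ) : ℝ) ((s : ℕ) : ℝ))⁻¹) ^ 2 ≤ 7 * ((s : ℕ) : ℝ)⁻¹ := by
  have hs0 : (0 : ℝ) < s := by exact_mod_cast hs
  have hs1 : (1 : ℝ) ≤ s := by exact_mod_cast hs
  rw [← sum_filter_add_sum_filter_not P (fun x : ℤ => x.natAbs ≤ s)]
  have h1 : ∑ x ∈ P with x.natAbs ≤ s, ((max ((x.natAbs : ℕ) : ℝ) ((s : ℕ) : ℝ))⁻¹) ^ 2 ≤ 3 * ((s : ℕ) : ℝ)⁻¹ := by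
    have hterm : ∀ x ∈ P.filter (fun x : ℤ => x.natAbs ≤ s), ((max ((x.natAbs : ℕ) : ℝ) ((s : ℕ) : ℝ))⁻¹) ^ 2 = (((s : ℕ) : ℝ)⁻¹) ^ 2 := by
      intro x hx
      rw [max_eq_right (by exact_mod_cast (mem_filter.mp hx).2)]
    rw [sum_congr rfl hterm, sum_const, nsmul_eq_mul]
    have hcard : (((P.filter (fun x : ℤ => x.natAbs ≤ s)).card : ℕ) : ℝ) ≤ 2 * s + 1 := by
      have hsub : P.filter (fun x : ℤ => x.natAbs ≤ s) ⊆ Icc (-(s : ℤ)) s := by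
        intro x hx
        have := (mem_filter.mp hx).2
        rw [mem_Icc]; omega
      have h := card_le_card hsub
      rw [Int.card_Icc] at h
      have h' : ((s : ℤ) + 1 - -(s : ℤ)).toNat = 2 * s + 1 := by omega
      rw [h'] at h
      exact_mod_cast h
    have h4 : (((s : ℕ) : ℝ)⁻¹) ^ 2 = ((s : ℕ) : ℝ)⁻¹ * ((s : ℕ) : ℝ)⁻¹ := pow_two _
    calc (((P.filter (fun x : ℤ => x.natAbs ≤ s)).card : ℕ) : ℝ) * (((s : ℕ) : ℝ)⁻¹) ^ 2 ≤ (2 * s + 1) * (((s : ℕ) : ℝ)⁻¹) ^ 2 := by gcongr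
      _ ≤ (3 * s) * (((s : ℕ) : ℝ)⁻¹) ^ 2 := by gcongr; linarith
      _ = 3 * ((s : ℕ) : ℝ)⁻¹ := by rw [h4, ← mul_assoc, mul_assoc 3, mul_inv_cancel₀ hs0.ne', mul_one]
  have h2 : ∑ x ∈ P with ¬ x.natAbs ≤ s, ((max ((x.natAbs : ℕ) : ℝ) ((s : ℕ) : ℝ))⁻¹) ^ 2 ≤ 4 * ((s : ℕ) : ℝ)⁻¹ := by
    have hmem : ∀ x ∈ P.filter (fun x : ℤ => ¬ x.natAbs ≤ s), s < x.natAbs := fun x hx => not_le.mp (mem_filter.mp hx).2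
    have hterm : ∀ x ∈ P.filter (fun x : ℤ => ¬ x.natAbs ≤ s),
        ((max ((x.natAbs : ℕ) : ℝ) ((s : ℕ) : ℝ))⁻¹) ^ 2 = (((x.natAbs : ℕ) : ℝ) ^ 2)⁻¹ := by
      intro x hx
      have hxs : ((s : ℕ) : ℝ) ≤ ((x.natAbs : ℕ) : ℝ) := by exact_mod_cast (hmem x hx).le
      rw [max_eq_left hxs, inv_pow]
    have hpos : ∑ x ∈ (P.filter fun x : ℤ => ¬ x.natAbs ≤ s) with 0 < x, (((x.natAbs : ℕ) : ℝ) ^ 2)⁻¹ ≤ 2 / ((s : ℝ) + 1) := by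
      refine sum_inv_sq_le_of_injOn Int.natAbs ?_ fun x hx => hmem x (mem_filter.mp hx).1
      intro x hx y hy hxy
      have hx' := (mem_filter.mp (mem_coe.mp hx)).2
      have hy' := (mem_filter.mp (mem_coe.mp hy)).2
      have h' : x.natAbs = y.natAbs := hxy
      omega
    have hneg : ∑ x ∈ (P.filter fun x : ℤ => ¬ x.natAbs ≤ s) with ¬ 0 < x, (((x.natAbs : ℕ) : ℝ) ^ 2)⁻¹ ≤ 2 / ((s : ℝ) + 1) := by
      refine sum_inv_sq_le_of_injOn Int.natAbs ?_ fun x hx => hmem x (mem_filter.mp hx).1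
      intro x hx y hy hxy
      have hx' := (mem_filter.mp (mem_coe.mp hx)).2
      have hy' := (mem_filter.mp (mem_coe.mp hy)).2
      have h' : x.natAbs = y.natAbs := hxy
      omega
    rw [sum_congr rfl hterm, ← sum_filter_add_sum_filter_not (P.filter fun x : ℤ => ¬ x.natAbs ≤ s) (fun x : ℤ => 0 < x)]
    have h41 : 2 / ((s : ℝ) + 1) ≤ 2 * ((s : ℕ) : ℝ)⁻¹ := by
      rw [← div_eq_mul_inv]
      exact div_le_div_of_nonneg_left (by norm_num) hs0 (by linarith)
    linarith
  linarith

/-! ### VU.2  The planar sum of `N⁻⁷` over a layer section -/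

/-- pointwise: for a site `Y` in layer `β ≠ α`, `N(Y − (0, α))⁻⁷ ≤ max(|Y₀|, s)⁻⁴ · max(|Y₁|, s)⁻² · s⁻¹` with `s = |β − α|`. [formal bookkeeping] -/
theorem inv_idxNorm_pow_seven_le (α β : ℤ) (hαβ : α ≠ β) (Y : Cell 2 × ℤ) (hY : Y.2 = β) :
    ((((idxNorm (Y - ((0 : Cell 2), α)) : ℕ) : ℝ))⁻¹) ^ 7 ≤
      ((max (((Y.1 0).natAbs : ℕ) : ℝ) ((((β - α).natAbs : ℕ)) : ℝ))⁻¹) ^ 4 *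
        ((max (((Y.1 1).natAbs : ℕ) : ℝ) ((((β - α).natAbs : ℕ)) : ℝ))⁻¹) ^ 2 * ((((β - α).natAbs : ℕ)) : ℝ)⁻¹ := by
  have hs : 1 ≤ (β - α).natAbs := Int.natAbs_pos.mpr (sub_ne_zero.mpr hαβ.symm)
  have hs0 : (0 : ℝ) < (((β - α).natAbs : ℕ) : ℝ) := by exact_mod_cast hs
  have h1 : ∀ j, (Y - ((0 : Cell 2), α)).1 j = Y.1 j := fun j => by simp
  have h2 : (Y - ((0 : Cell 2), α)).2 = β - α := by simp [hY]
  have hj : ∀ j, max (Y.1 j).natAbs (β - α).natAbs ≤ idxNorm (Y - ((0 : Cell 2), α)) := fun j => by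
    refine max_le ?_ ?_
    · have h := natAbs_fst_le_idxNorm (Y - ((0 : Cell 2), α)) j
      rwa [h1 j] at h
    · have h := natAbs_snd_le_idxNorm (Y - ((0 : Cell 2), α))
      rwa [h2] at h
  have hjR : ∀ j, max (((Y.1 j).natAbs : ℕ) : ℝ) ((((β - α).natAbs : ℕ)) : ℝ) ≤ ((idxNorm (Y - ((0 : Cell 2), α)) : ℕ) : ℝ) := fun j => by
    rw [← Nat.cast_max]; exact_mod_cast hj j
  have hsN : ((((β - α).natAbs : ℕ)) : ℝ) ≤ ((idxNorm (Y - ((0 : Cell 2), α)) : ℕ) : ℝ) := (le_max_right _ _).trans (hjR 0)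
  calc ((((idxNorm (Y - ((0 : Cell 2), α)) : ℕ) : ℝ))⁻¹) ^ 7
      = ((((idxNorm (Y - ((0 : Cell 2), α)) : ℕ) : ℝ))⁻¹) ^ 4 * ((((idxNorm (Y - ((0 : Cell 2), α)) : ℕ) : ℝ))⁻¹) ^ 2 *
          (((idxNorm (Y - ((0 : Cell 2), α)) : ℕ) : ℝ))⁻¹ := by ring
    _ ≤ ((max (((Y.1 0).natAbs : ℕ) : ℝ) ((((β - α).natAbs : ℕ)) : ℝ))⁻¹) ^ 4 *
          ((max (((Y.1 1).natAbs : ℕ) : ℝ) ((((β - α).natAbs : ℕ)) : ℝ))⁻¹) ^ 2 * ((((β - α).natAbs : ℕ)) : ℝ)⁻¹ := by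
        gcongr
        · exact hjR 0
        · exact hjR 1

/-- ★ THE LAYER-SECTION SUM of order seven: over any finite family of sites in layer `β ≠ α`, `Σ_Y N(Y − (0, α))⁻⁷ ≤ 49·|β − α|⁻⁵` (product
embedding of the section; VR `sum_inv_max_pow_four_le` times `sum_inv_max_sq_le` times `s⁻¹`). [this file, g58] -/
theorem sum_inv_idxNorm_pow_seven_le (α β : ℤ) (hαβ : α ≠ β) (Q : Finset (Cell 2 × ℤ)) (hQ : ∀ Y ∈ Q, Y.2 = β) :
    ∑ Y ∈ Q, ((((idxNorm (Y - ((0 : Cell 2), α)) : ℕ) : ℝ))⁻¹) ^ 7 ≤ 49 * (((((β - α).natAbs : ℕ) : ℝ))⁻¹) ^ 5 := by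
  classical
  have hs : 1 ≤ (β - α).natAbs := Int.natAbs_pos.mpr (sub_ne_zero.mpr hαβ.symm)
  have hs0 : (0 : ℝ) < (((β - α).natAbs : ℕ) : ℝ) := by exact_mod_cast hs
  set g₄ : ℤ → ℝ := fun x => ((max ((x.natAbs : ℕ) : ℝ) ((((β - α).natAbs : ℕ)) : ℝ))⁻¹) ^ 4 with hg₄
  set g₂ : ℤ → ℝ := fun x => ((max ((x.natAbs : ℕ) : ℝ) ((((β - α).natAbs : ℕ)) : ℝ))⁻¹) ^ 2 with hg₂
  have hg₄0 : ∀ x, 0 ≤ g₄ x := fun x => by rw [hg₄]; positivity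
  have hg₂0 : ∀ x, 0 ≤ g₂ x := fun x => by rw [hg₂]; positivity
  have hT₄ : ∀ R : Finset ℤ, ∑ x ∈ R, g₄ x ≤ 7 * (((((β - α).natAbs : ℕ) : ℝ))⁻¹) ^ 3 := fun R => sum_inv_max_pow_four_le R hs
  have hT₂ : ∀ R : Finset ℤ, ∑ x ∈ R, g₂ x ≤ 7 * ((((β - α).natAbs : ℕ) : ℝ))⁻¹ := fun R => sum_inv_max_sq_le R hs
  have hT0 : ∀ R : Finset ℤ, 0 ≤ ∑ x ∈ R, g₄ x := fun R => sum_nonneg fun x _ => hg₄0 x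
  have he : Set.InjOn (fun Y : Cell 2 × ℤ => (Y.1 0, Y.1 1)) Q := by
    intro Y hY Y' hY' hYY'
    simp only [Prod.mk.injEq] at hYY'
    refine Prod.ext (funext fun j => ?_) (by rw [hQ Y (mem_coe.mp hY), hQ Y' (mem_coe.mp hY')])
    exact (Fin.forall_fin_two (p := fun j => Y.1 j = Y'.1 j)).mpr hYY' j
  calc ∑ Y ∈ Q, ((((idxNorm (Y - ((0 : Cell 2), α)) : ℕ) : ℝ))⁻¹) ^ 7
      ≤ ∑ Y ∈ Q, g₄ (Y.1 0) * g₂ (Y.1 1) * ((((β - α).natAbs : ℕ)) : ℝ)⁻¹ :=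
        sum_le_sum fun Y hY => inv_idxNorm_pow_seven_le α β hαβ Y (hQ Y hY)
    _ = (∑ Y ∈ Q, g₄ (Y.1 0) * g₂ (Y.1 1)) * ((((β - α).natAbs : ℕ)) : ℝ)⁻¹ := by rw [sum_mul]
    _ ≤ (∑ p ∈ (Q.image fun Y : Cell 2 × ℤ => Y.1 0) ×ˢ (Q.image fun Y : Cell 2 × ℤ => Y.1 1), g₄ p.1 * g₂ p.2) *
          ((((β - α).natAbs : ℕ)) : ℝ)⁻¹ := by
        refine mul_le_mul_of_nonneg_right ?_ (inv_nonneg.mpr hs0.le)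
        exact sum_le_sum_of_injOn' (fun Y : Cell 2 × ℤ => (Y.1 0, Y.1 1)) he
          (fun Y hY => mem_product.mpr ⟨mem_image_of_mem _ hY, mem_image_of_mem _ hY⟩) (fun p _ => mul_nonneg (hg₄0 _) (hg₂0 _))
          fun Y _ => le_rfl
    _ = (∑ x ∈ Q.image fun Y : Cell 2 × ℤ => Y.1 0, g₄ x) * (∑ y ∈ Q.image fun Y : Cell 2 × ℤ => Y.1 1, g₂ y) *
          ((((β - α).natAbs : ℕ)) : ℝ)⁻¹ := by
        rw [sum_product, sum_mul_sum]
    _ ≤ (7 * (((((β - α).natAbs : ℕ) : ℝ))⁻¹) ^ 3) * (7 * ((((β - α).natAbs : ℕ) : ℝ))⁻¹) * ((((β - α).natAbs : ℕ)) : ℝ)⁻¹ :=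
        mul_le_mul_of_nonneg_right (mul_le_mul (hT₄ _) (hT₂ _) (sum_nonneg fun x _ => hg₂0 x) (by positivity)) (inv_nonneg.mpr hs0.le)
    _ = 49 * (((((β - α).natAbs : ℕ) : ℝ))⁻¹) ^ 5 := by ring

/-! ### VU.3  ★ The `ϱ`-uniform decay of the slope blocks -/

/-- the slope vector between two sites is dominated by their index distance: `‖Σ_j (Y_j − X_j) • g j‖ ≤ N(Y − X)·(‖g 0‖ + ‖g 1‖)`. [formal bookkeeping] -/
theorem norm_slopeVec_le (X Y : Cell 2 × ℤ) (g : Fin 2 → E3) :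
    ‖∑ j, (((Y.1 j - X.1 j : ℤ)) : ℝ) • g j‖ ≤ ((idxNorm (Y - X) : ℕ) : ℝ) * (‖g 0‖ + ‖g 1‖) := by
  have hj : ∀ j, |(((Y.1 j - X.1 j : ℤ)) : ℝ)| ≤ ((idxNorm (Y - X) : ℕ) : ℝ) := fun j => by
    rw [← Int.cast_abs, ← Nat.cast_natAbs]
    have h : (Y.1 j - X.1 j).natAbs ≤ idxNorm (Y - X) := natAbs_fst_le_idxNorm (Y - X) j
    exact_mod_cast h
  calc ‖∑ j, (((Y.1 j - X.1 j : ℤ)) : ℝ) • g j‖ ≤ ∑ j, ‖(((Y.1 j - X.1 j : ℤ)) : ℝ) • g j‖ := norm_sum_le _ _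
    _ = ∑ j, |(((Y.1 j - X.1 j : ℤ)) : ℝ)| * ‖g j‖ := by simp_rw [norm_smul, Real.norm_eq_abs]
    _ ≤ ∑ j, ((idxNorm (Y - X) : ℕ) : ℝ) * ‖g j‖ := sum_le_sum fun j _ => mul_le_mul_of_nonneg_right (hj j) (norm_nonneg _)
    _ = ((idxNorm (Y - X) : ℕ) : ℝ) * (‖g 0‖ + ‖g 1‖) := by rw [Fin.sum_univ_two, mul_add]

/-- `N⁻⁸·N ≤ N⁻⁷` (with the junk value `0⁻¹ = 0`). [formal bookkeeping] -/
theorem inv_pow_eight_mul_le (N : ℝ) : (N⁻¹) ^ 8 * N ≤ (N⁻¹) ^ 7 := by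
  rcases eq_or_ne N 0 with h | h
  · rw [h]; simp
  · rw [pow_succ, mul_assoc, inv_mul_cancel₀ h, mul_one]

/-- ★ SLOPE BLOCK DECAY: `‖slopeK (0,α) β g‖ ≤ 49·F(c)·|β − α|⁻⁵·(‖g 0‖ + ‖g 1‖)` for `α ≠ β`, UNIFORMLY IN `ϱ` (UY `norm_layeredKernel_le` on each
bond of the layer-`β` section, the linear growth of the slope vector, and `sum_inv_idxNorm_pow_seven_le`). [this file, g58] -/
theorem norm_slopeK_le_decay (hc : 0 < c) (hL : IsLayeredCrystal c a b w) (ϱ : ℝ) {α β : ℤ} (hαβ : α ≠ β) (g : Fin 2 → E3) :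
    ‖slopeK ϱ a b w ((0 : Cell 2), α) β g‖ ≤ 49 * kernelConst c * (((((β - α).natAbs : ℕ) : ℝ))⁻¹) ^ 5 * (‖g 0‖ + ‖g 1‖) := by
  have hF := kernelConst_nonneg hc
  have hG : 0 ≤ ‖g 0‖ + ‖g 1‖ := by positivity
  have hN : ∀ Y : Cell 2 × ℤ, ‖lsite a b w Y.1 Y.2 - lsite a b w ((0 : Cell 2), α).1 ((0 : Cell 2), α).2‖ ≤ ϱ →
      Y ∈ (finite_near_lsite hc hL ((0 : Cell 2), α) ϱ).toFinset :=
    fun _ hY => (finite_near_lsite hc hL ((0 : Cell 2), α) ϱ).mem_toFinset.mpr hY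
  rw [slopeK_eq_sum hN]
  have hQ : ∀ Y ∈ (finite_near_lsite hc hL ((0 : Cell 2), α) ϱ).toFinset.filter (fun Y => Y.2 = β), Y.2 = β :=
    fun Y hY => (mem_filter.mp hY).2
  have hterm : ∀ Y : Cell 2 × ℤ, ‖nearK ϱ a b w ((0 : Cell 2), α) Y (∑ j, (((Y.1 j - ((0 : Cell 2), α).1 j : ℤ)) : ℝ) • g j)‖ ≤
      kernelConst c * ((((idxNorm (Y - ((0 : Cell 2), α)) : ℕ) : ℝ))⁻¹) ^ 7 * (‖g 0‖ + ‖g 1‖) := fun Y =>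
    calc ‖nearK ϱ a b w ((0 : Cell 2), α) Y (∑ j, (((Y.1 j - ((0 : Cell 2), α).1 j : ℤ)) : ℝ) • g j)‖
        ≤ ‖layeredKernel a b w (Y.1 - ((0 : Cell 2), α).1) ((0 : Cell 2), α).2 Y.2‖ *
            ‖∑ j, (((Y.1 j - ((0 : Cell 2), α).1 j : ℤ)) : ℝ) • g j‖ := norm_nearK_le ϱ a b w _ Y _
      _ ≤ (kernelConst c * ((((idxNorm (Y - ((0 : Cell 2), α)) : ℕ) : ℝ))⁻¹) ^ 8) *
            (((idxNorm (Y - ((0 : Cell 2), α)) : ℕ) : ℝ) * (‖g 0‖ + ‖g 1‖)) :=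
          mul_le_mul (norm_layeredKernel_le hc hL _ Y) (norm_slopeVec_le _ Y g) (norm_nonneg _) (by positivity)
      _ = kernelConst c * (((((idxNorm (Y - ((0 : Cell 2), α)) : ℕ) : ℝ))⁻¹) ^ 8 * (((idxNorm (Y - ((0 : Cell 2), α)) : ℕ) : ℝ))) *
            (‖g 0‖ + ‖g 1‖) := by ring
      _ ≤ kernelConst c * ((((idxNorm (Y - ((0 : Cell 2), α)) : ℕ) : ℝ))⁻¹) ^ 7 * (‖g 0‖ + ‖g 1‖) :=
          mul_le_mul_of_nonneg_right (mul_le_mul_of_nonneg_left (inv_pow_eight_mul_le _) hF) hG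
  calc ‖∑ Y ∈ (finite_near_lsite hc hL ((0 : Cell 2), α) ϱ).toFinset with Y.2 = β,
          nearK ϱ a b w ((0 : Cell 2), α) Y (∑ j, (((Y.1 j - ((0 : Cell 2), α).1 j : ℤ)) : ℝ) • g j)‖
      ≤ ∑ Y ∈ (finite_near_lsite hc hL ((0 : Cell 2), α) ϱ).toFinset with Y.2 = β,
          ‖nearK ϱ a b w ((0 : Cell 2), α) Y (∑ j, (((Y.1 j - ((0 : Cell 2), α).1 j : ℤ)) : ℝ) • g j)‖ := norm_sum_le _ _
    _ ≤ ∑ Y ∈ (finite_near_lsite hc hL ((0 : Cell 2), α) ϱ).toFinset with Y.2 = β,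
          kernelConst c * ((((idxNorm (Y - ((0 : Cell 2), α)) : ℕ) : ℝ))⁻¹) ^ 7 * (‖g 0‖ + ‖g 1‖) := sum_le_sum fun Y _ => hterm Y
    _ = kernelConst c * (∑ Y ∈ (finite_near_lsite hc hL ((0 : Cell 2), α) ϱ).toFinset with Y.2 = β,
          ((((idxNorm (Y - ((0 : Cell 2), α)) : ℕ) : ℝ))⁻¹) ^ 7) * (‖g 0‖ + ‖g 1‖) := by
        rw [mul_sum, sum_mul]
    _ ≤ kernelConst c * (49 * (((((β - α).natAbs : ℕ) : ℝ))⁻¹) ^ 5) * (‖g 0‖ + ‖g 1‖) :=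
        mul_le_mul_of_nonneg_right (mul_le_mul_of_nonneg_left (sum_inv_idxNorm_pow_seven_le α β hαβ _ hQ) hF) hG
    _ = 49 * kernelConst c * (((((β - α).natAbs : ℕ) : ℝ))⁻¹) ^ 5 * (‖g 0‖ + ‖g 1‖) := by ring

/-! ### VU.4  ★★ The uniform bound of the box slope flux -/

/-- `(u + v − 1)⁻⁵ ≤ u⁻²·v⁻²` for `u, v ≥ 1` (`uv ≤ (u + v − 1)²`). [formal bookkeeping] -/
theorem inv_pow_five_le {u v : ℝ} (hu : 1 ≤ u) (hv : 1 ≤ v) : ((u + v - 1)⁻¹) ^ 5 ≤ (u⁻¹) ^ 2 * (v⁻¹) ^ 2 := by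
  have ht : 1 ≤ u + v - 1 := by linarith
  have huv0 : 0 < u * v := by positivity
  have huv : u * v ≤ (u + v - 1) ^ 2 := by
    nlinarith [mul_nonneg (sub_nonneg.mpr hu) (sub_nonneg.mpr hv), sq_nonneg (u - 1), sq_nonneg (v - 1)]
  have h1 : (u * v) ^ 2 ≤ (u + v - 1) ^ 5 :=
    calc (u * v) ^ 2 ≤ ((u + v - 1) ^ 2) ^ 2 := pow_le_pow_left₀ huv0.le huv 2
      _ = (u + v - 1) ^ 4 := by ring
      _ ≤ (u + v - 1) ^ 5 := pow_le_pow_right₀ ht (by norm_num)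
  rw [← mul_pow, ← mul_inv, inv_pow, inv_pow]
  exact inv_anti₀ (by positivity) h1

/-- in the band box the height decay splits: `|β − α|⁻⁵ ≤ (|m − α| + 1)⁻²·(|β − (m+1)| + 1)⁻²` for `α ≤ m < β`. [formal bookkeeping] -/
theorem inv_natAbs_pow_five_le {α β m : ℤ} (hα : α ≤ m) (hβ : m + 1 ≤ β) :
    (((((β - α).natAbs : ℕ) : ℝ))⁻¹) ^ 5 ≤
      (((((m - α).natAbs : ℕ) : ℝ) + 1)⁻¹) ^ 2 * (((((β - (m + 1)).natAbs : ℕ) : ℝ) + 1)⁻¹) ^ 2 := by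
  have hu : (1 : ℝ) ≤ (((m - α).natAbs : ℕ) : ℝ) + 1 := by
    have h0 : (0 : ℝ) ≤ (((m - α).natAbs : ℕ) : ℝ) := Nat.cast_nonneg _
    linarith
  have hv : (1 : ℝ) ≤ (((β - (m + 1)).natAbs : ℕ) : ℝ) + 1 := by
    have h0 : (0 : ℝ) ≤ (((β - (m + 1)).natAbs : ℕ) : ℝ) := Nat.cast_nonneg _
    linarith
  have h1 : ((β - α).natAbs : ℤ) = (m - α).natAbs + (β - (m + 1)).natAbs + 1 := by omega
  have h2 : (((β - α).natAbs : ℕ) : ℝ) = (((m - α).natAbs : ℕ) : ℝ) + (((β - (m + 1)).natAbs : ℕ) : ℝ) + 1 := by exact_mod_cast h1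
  have h3 : (((β - α).natAbs : ℕ) : ℝ) = ((((m - α).natAbs : ℕ) : ℝ) + 1) + ((((β - (m + 1)).natAbs : ℕ) : ℝ) + 1) - 1 := by
    rw [h2]; ring
  rw [h3]
  exact inv_pow_five_le hu hv

/-- ★★ THE UNIFORM BOUND OF THE BOX SLOPE FLUX: `‖boxSlope ϱ a b w r g m‖ ≤ 441·F(c)·(‖g 0‖ + ‖g 1‖)` for every band width `r`, every `ϱ`,
every gap `m` and every stacking word (slope block decay, the split `|β − α|⁻⁵ ≤ (m − α + 1)⁻²(β − m)⁻²`, and VS `Σ (|m − n| + 1)⁻² ≤ 3` twice).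
[this file, g58] -/
theorem norm_boxSlope_le (hc : 0 < c) (hL : IsLayeredCrystal c a b w) (ϱ : ℝ) (r : ℕ) (g : Fin 2 → E3) (m : ℤ) :
    ‖boxSlope ϱ a b w r g m‖ ≤ 441 * kernelConst c * (‖g 0‖ + ‖g 1‖) := by
  have hF := kernelConst_nonneg hc
  have hG : 0 ≤ ‖g 0‖ + ‖g 1‖ := by positivity
  unfold boxSlope
  have hterm : ∀ α ∈ Icc (m - (r : ℤ)) m, ∀ β ∈ Icc (m + 1) (m + 1 + (r : ℤ)), ‖slopeK ϱ a b w ((0 : Cell 2), α) β g‖ ≤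
      49 * kernelConst c * ((((((m - α).natAbs : ℕ) : ℝ) + 1)⁻¹) ^ 2 * (((((β - (m + 1)).natAbs : ℕ) : ℝ) + 1)⁻¹) ^ 2) *
        (‖g 0‖ + ‖g 1‖) := by
    intro α hα β hβ
    rw [mem_Icc] at hα hβ
    refine (norm_slopeK_le_decay hc hL ϱ (by omega) g).trans ?_
    exact mul_le_mul_of_nonneg_right (mul_le_mul_of_nonneg_left (inv_natAbs_pow_five_le hα.2 hβ.1) (mul_nonneg (by norm_num) hF)) hG
  have hA := sum_inv_sq_natAbs_succ_le (Icc (m - (r : ℤ)) m) m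
  have hB := sum_inv_sq_natAbs_succ_le' (Icc (m + 1) (m + 1 + (r : ℤ))) (m + 1)
  have hA0 : 0 ≤ ∑ α ∈ Icc (m - (r : ℤ)) m, (((((m - α).natAbs : ℕ) : ℝ) + 1)⁻¹) ^ 2 := sum_nonneg fun _ _ => by positivity
  calc ‖∑ α ∈ Icc (m - (r : ℤ)) m, ∑ β ∈ Icc (m + 1) (m + 1 + (r : ℤ)), slopeK ϱ a b w ((0 : Cell 2), α) β g‖
      ≤ ∑ α ∈ Icc (m - (r : ℤ)) m, ‖∑ β ∈ Icc (m + 1) (m + 1 + (r : ℤ)), slopeK ϱ a b w ((0 : Cell 2), α) β g‖ := norm_sum_le _ _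
    _ ≤ ∑ α ∈ Icc (m - (r : ℤ)) m, ∑ β ∈ Icc (m + 1) (m + 1 + (r : ℤ)), ‖slopeK ϱ a b w ((0 : Cell 2), α) β g‖ :=
        sum_le_sum fun α _ => norm_sum_le _ _
    _ ≤ ∑ α ∈ Icc (m - (r : ℤ)) m, ∑ β ∈ Icc (m + 1) (m + 1 + (r : ℤ)),
          49 * kernelConst c * ((((((m - α).natAbs : ℕ) : ℝ) + 1)⁻¹) ^ 2 * (((((β - (m + 1)).natAbs : ℕ) : ℝ) + 1)⁻¹) ^ 2) *
            (‖g 0‖ + ‖g 1‖) :=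
        sum_le_sum fun α hα => sum_le_sum fun β hβ => hterm α hα β hβ
    _ = 49 * kernelConst c * (‖g 0‖ + ‖g 1‖) * ((∑ α ∈ Icc (m - (r : ℤ)) m, (((((m - α).natAbs : ℕ) : ℝ) + 1)⁻¹) ^ 2) *
          ∑ β ∈ Icc (m + 1) (m + 1 + (r : ℤ)), (((((β - (m + 1)).natAbs : ℕ) : ℝ) + 1)⁻¹) ^ 2) := by
        rw [sum_mul_sum, mul_sum]
        refine sum_congr rfl fun α _ => ?_
        rw [mul_sum]
        refine sum_congr rfl fun β _ => ?_
        ring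
    _ ≤ 49 * kernelConst c * (‖g 0‖ + ‖g 1‖) * (3 * 3) :=
        mul_le_mul_of_nonneg_left (mul_le_mul hA hB (sum_nonneg fun _ _ => by positivity) (by norm_num)) (by positivity)
    _ = 441 * kernelConst c * (‖g 0‖ + ‖g 1‖) := by ring

end SlopeDecay

end Summit.AtomisticToContinuum.Crystallization.Theorems.ChartedZeroExcessLayeredLatticeLiouville
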